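import Literature.Probability.RandomPlanarGeometry.HexSAWPolygonCellsHosts
import Literature.Probability.RandomPlanarGeometry.SAWBrickWallHex
import HarnessLib

/-!
# Cell calculus for honeycomb polygon surgery, XVII: the BOUNDARY BOND SET of a set of hexagons (`#bdry S = perim S`)

Topic `Literature/Probability/RandomPlanarGeometry` (lane «pcv-sawmu», a-p4 g22; sequel of `HexSAWPolygonCells.lean` (I: `perim`) and
`HexSAWPolygonCellsHosts.lean` (III: `IsBrickSet`); first module of the BRIDGE between the cell-set layer of the step-two injection «OMEGA»
(`HOME/pub-sawmu-a-p4/g21/omega/THEOREM-OMEGA-g21.md`) and the tree's polygons as bond sets (`IsPolygon brickWallGraph E`,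
`SupercriticalSAWPolygons`, `HexSAWPolygonLoopEdges`, `exists_canonEnd_of_isPolygon`)).

A hexagon `c = (x, y)` (`x + y` even) of the brick-wall honeycomb lattice `ℍ ⊆ ℤ²` is the brick `[x, x+2] × [y, y+1]`; its six lattice bonds are
the two halves of its bottom side, the two halves of its top side and its two vertical sides, and the bond it shares with the neighbour
`d ∈ nbrs c` is `bond c d` (a vertical unit bond for `d = L c, R c`, a horizontal one for the four diagonal neighbours).  The BOUNDARY of a
finite set `S` of hexagons is the bond set `bdry S := ⋃_{c ∈ S} {bond c d : d ∈ nbrs c ∖ S}`.  This file proves the dictionary: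

* (`Site 2` coordinates via the tree's `site_two_eq_iff` (`HexSAWLattice`)); `bond_comm` (the shared bond is the same seen from either side), the six normal forms `bond_ll`, …, `bond_l`, `bond_mem_edgeSet`
  (it is a bond of `brickWallGraph`), `bond_injOn` (the six bonds of a hexagon are distinct);
* ★ `cells_of_bond_eq` — a bond determines its two hexagons: `bond c d = bond c' d'` with `d ∈ nbrs c`, `d' ∈ nbrs c'` (bricks) forces
  `{c, d} = {c', d'}`;
* `mem_bdry_iff`, ★ `card_bdry : #(bdry S) = perim S` for brick sets, `bdry_insert` (inserting a hexagon removes the bonds towards its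
  contacts and adds the bonds towards its free neighbours — the bond-set form of `perim_insert`), `bdry_eq_bdry_iff`-type injectivity
  ★ `eq_of_bdry_eq` (two finite brick sets with the same boundary coincide: look at the top hexagon of their symmetric difference).

Sources: N. Madras, G. Slade, *The Self-Avoiding Walk* (1993), §3.2, Definition 3.2.1 p. 62 (a polygon as a set of bonds) and the proof of
Theorem 3.2.3 [MadrasSlade1993]; I. Jensen, J. Phys.: Conf. Ser. 42 (2006) 163 (honeycomb polygons by perimeter = number of boundary bonds of
the enclosed hexagons) [Jensen2006HoneycombPolygons]; I. G. Enting, I. Jensen, LNP 775 (2009) §7.4.2, Fig. 7.10 (brickwork form of the honeycomb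
lattice) [EntingJensen2009].  Label (lane): LANE INFRASTRUCTURE; nothing new in writing.
-/

open Finset Literature.Probability.LatticeModels

namespace Literature.Probability.RandomPlanarGeometry.SAW

namespace HexCell

/-! ### Sites and bonds in coordinates -/

/-- `![a, b] = ![a', b'] ↔ a = a' ∧ b = b'` (coordinates: the tree's `site_two_eq_iff`). [folklore; lane plumbing] [cite: EntingJensen2009, §7.4.2] -/
theorem bwVec_eq_iff (a b a' b' : ℤ) : (![a, b] : Site 2) = ![a', b'] ↔ a = a' ∧ b = b' := by
  rw [site_two_eq_iff]; simp

/-- The horizontal unit bond `(a, h) – (a+1, h)`. [cite: EntingJensen2009, §7.4.2, Fig. 7.10] -/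
def hbond (a h : ℤ) : Sym2 (Site 2) := s(![a, h], ![a + 1, h])

/-- The vertical unit bond `(a, h) – (a, h+1)`. [cite: EntingJensen2009, §7.4.2, Fig. 7.10] -/
def vbond (a h : ℤ) : Sym2 (Site 2) := s(![a, h], ![a, h + 1])

/-- `hbond` is injective. [cite: EntingJensen2009, §7.4.2] -/
theorem hbond_eq_hbond_iff {a h a' h' : ℤ} : hbond a h = hbond a' h' ↔ a = a' ∧ h = h' := by
  constructor
  · intro e
    rcases Sym2.eq_iff.1 e with ⟨h1, h2⟩ | ⟨h1, h2⟩ <;> rw [bwVec_eq_iff] at h1 h2 <;> omega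
  · rintro ⟨rfl, rfl⟩; rfl

/-- `vbond` is injective. [cite: EntingJensen2009, §7.4.2] -/
theorem vbond_eq_vbond_iff {a h a' h' : ℤ} : vbond a h = vbond a' h' ↔ a = a' ∧ h = h' := by
  constructor
  · intro e
    rcases Sym2.eq_iff.1 e with ⟨h1, h2⟩ | ⟨h1, h2⟩ <;> rw [bwVec_eq_iff] at h1 h2 <;> omega
  · rintro ⟨rfl, rfl⟩; rfl

/-- A horizontal bond is never a vertical bond. [cite: EntingJensen2009, §7.4.2] -/
theorem hbond_ne_vbond (a h a' h' : ℤ) : hbond a h ≠ vbond a' h' := by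
  intro e
  rcases Sym2.eq_iff.1 e with ⟨h1, h2⟩ | ⟨h1, h2⟩ <;> rw [bwVec_eq_iff] at h1 h2 <;> omega

/-- Horizontal unit bonds are bonds of the brick wall. [cite: EntingJensen2009, §7.4.2, Fig. 7.10] -/
theorem hbond_mem_edgeSet (a h : ℤ) : hbond a h ∈ brickWallGraph.edgeSet := by
  rw [hbond, SimpleGraph.mem_edgeSet, brickWallGraph_adj]
  refine ⟨(zdGraph_adj_iff _ _).2 ⟨0, Or.inl ?_⟩, fun hodd => ?_⟩
  · funext i; fin_cases i <;> simp
  · exact absurd hodd.1 (by simp)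

/-- The vertical unit bond `(a, h) – (a, h+1)` is a bond of the brick wall iff `a + h` is even. [cite: EntingJensen2009, §7.4.2, Fig. 7.10] -/
theorem vbond_mem_edgeSet {a h : ℤ} (hpar : Even (a + h)) : vbond a h ∈ brickWallGraph.edgeSet := by
  rw [vbond, SimpleGraph.mem_edgeSet, brickWallGraph_adj]
  refine ⟨(zdGraph_adj_iff _ _).2 ⟨1, Or.inl ?_⟩, fun hodd => ?_⟩
  · funext i; fin_cases i <;> simp
  · have := hodd.2
    simp only [Matrix.cons_val_zero, Matrix.cons_val_one, min_eq_left (le_add_of_nonneg_right zero_le_one)] at this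
    obtain ⟨m, hm⟩ := hpar
    omega

/-! ### The bond shared by two neighbouring hexagons -/

/-- **The bond of the hexagon `c` facing `d`** (for `d ∈ nbrs c`): the vertical side at abscissa `max c.x d.x` for the horizontal neighbours
`L c`, `R c`, the half top/bottom side starting at `(max c.x d.x, max c.y d.y)` for the four diagonal neighbours.
[cite: Jensen2006HoneycombPolygons, §2 (hexagons and their bonds)] [cite: EntingJensen2009, §7.4.2, Fig. 7.10] -/
def bond (c d : Cell) : Sym2 (Site 2) :=
  if c.2 = d.2 then vbond (max c.1 d.1) c.2 else hbond (max c.1 d.1) (max c.2 d.2)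

/-- The shared bond is the same seen from either hexagon. [cite: Jensen2006HoneycombPolygons, §2] -/
theorem bond_comm (c d : Cell) : bond c d = bond d c := by
  unfold bond
  by_cases h : c.2 = d.2
  · rw [if_pos h, if_pos h.symm, max_comm, h]
  · rw [if_neg h, if_neg (Ne.symm h), max_comm c.1, max_comm c.2]

/-- Normal form: the bond towards `LL`. [cite: EntingJensen2009, §7.4.2, Fig. 7.10] -/
theorem bond_ll (x y : ℤ) : bond (x, y) (x - 1, y - 1) = hbond x y := by
  simp [bond, show ¬ (y = y - 1) by omega]

/-- Normal form: the bond towards `LR`. [cite: EntingJensen2009, §7.4.2, Fig. 7.10] -/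
theorem bond_lr (x y : ℤ) : bond (x, y) (x + 1, y - 1) = hbond (x + 1) y := by
  simp [bond, show ¬ (y = y - 1) by omega]

/-- Normal form: the bond towards `R`. [cite: EntingJensen2009, §7.4.2, Fig. 7.10] -/
theorem bond_r (x y : ℤ) : bond (x, y) (x + 2, y) = vbond (x + 2) y := by
  simp [bond]

/-- Normal form: the bond towards `UR`. [cite: EntingJensen2009, §7.4.2, Fig. 7.10] -/
theorem bond_ur (x y : ℤ) : bond (x, y) (x + 1, y + 1) = hbond (x + 1) (y + 1) := by
  simp [bond, show ¬ (y = y + 1) by omega]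

/-- Normal form: the bond towards `UL`. [cite: EntingJensen2009, §7.4.2, Fig. 7.10] -/
theorem bond_ul (x y : ℤ) : bond (x, y) (x - 1, y + 1) = hbond x (y + 1) := by
  simp [bond, show ¬ (y = y + 1) by omega]

/-- Normal form: the bond towards `L`. [cite: EntingJensen2009, §7.4.2, Fig. 7.10] -/
theorem bond_l (x y : ℤ) : bond (x, y) (x - 2, y) = vbond x y := by
  simp [bond]

/-- The bond towards a neighbour is a bond of the brick wall (hexagons are bricks: `x + y` even).
[cite: EntingJensen2009, §7.4.2, Fig. 7.10] -/
theorem bond_mem_edgeSet {c d : Cell} (hc : Even (c.1 + c.2)) (hd : d ∈ nbrs c) : bond c d ∈ brickWallGraph.edgeSet := by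
  obtain ⟨x, y⟩ := c
  simp only [mem_nbrs_iff] at hd
  rcases hd with rfl | rfl | rfl | rfl | rfl | rfl
  · rw [bond_ll]; exact hbond_mem_edgeSet _ _
  · rw [bond_lr]; exact hbond_mem_edgeSet _ _
  · rw [bond_r]; exact vbond_mem_edgeSet (by simpa [add_right_comm] using hc.add (even_two : Even (2 : ℤ)))
  · rw [bond_ur]; exact hbond_mem_edgeSet _ _
  · rw [bond_ul]; exact hbond_mem_edgeSet _ _
  · rw [bond_l]; exact vbond_mem_edgeSet hc

/-- The six bonds of a hexagon are distinct. [cite: Jensen2006HoneycombPolygons, §2] -/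
theorem bond_injOn (c : Cell) : Set.InjOn (bond c) (nbrs c : Set Cell) := by
  intro d hd d' hd' h
  obtain ⟨x, y⟩ := c
  simp only [mem_coe, mem_nbrs_iff] at hd hd'
  rcases hd with rfl | rfl | rfl | rfl | rfl | rfl <;> rcases hd' with rfl | rfl | rfl | rfl | rfl | rfl <;>
    simp only [bond_ll, bond_lr, bond_r, bond_ur, bond_ul, bond_l, hbond_eq_hbond_iff, vbond_eq_vbond_iff, Prod.mk.injEq] at h ⊢ <;>
    first | omega | exact absurd h (hbond_ne_vbond _ _ _ _) | exact absurd h.symm (hbond_ne_vbond _ _ _ _)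

/-- ★ **A bond determines its two hexagons**: if the hexagons `c`, `c'` (bricks) share the bond `bond c d = bond c' d'` with neighbours `d`, `d'`,
then `{c, d} = {c', d'}`. [cite: Jensen2006HoneycombPolygons, §2 (each bond of the honeycomb lattice separates two hexagons)] -/
theorem cells_of_bond_eq {c d c' d' : Cell} (hc : Even (c.1 + c.2)) (hc' : Even (c'.1 + c'.2))
    (hd : d ∈ nbrs c) (hd' : d' ∈ nbrs c') (h : bond c d = bond c' d') :
    (c = c' ∧ d = d') ∨ (c = d' ∧ d = c') := by
  obtain ⟨x, y⟩ := c
  obtain ⟨x', y'⟩ := c'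
  obtain ⟨m, hm⟩ := hc
  obtain ⟨m', hm'⟩ := hc'
  simp only at hm hm'
  simp only [mem_nbrs_iff] at hd hd'
  rcases hd with rfl | rfl | rfl | rfl | rfl | rfl <;> rcases hd' with rfl | rfl | rfl | rfl | rfl | rfl <;>
    simp only [bond_ll, bond_lr, bond_r, bond_ur, bond_ul, bond_l, hbond_eq_hbond_iff, vbond_eq_vbond_iff, Prod.mk.injEq] at h ⊢ <;>
    first | omega | exact absurd h (hbond_ne_vbond _ _ _ _) | exact absurd h.symm (hbond_ne_vbond _ _ _ _)

/-! ### The boundary bond set -/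

/-- **The boundary of a set of hexagons**: the bonds of its hexagons facing a hexagon outside the set.
[cite: Jensen2006HoneycombPolygons, §2 (polygons by perimeter: the boundary bonds of the enclosed hexagons)]
[cite: MadrasSlade1993, Definition 3.2.1 p. 62 (a polygon as a set of bonds)] -/
def bdry (S : Finset Cell) : Finset (Sym2 (Site 2)) := S.biUnion fun c => (nbrs c \ S).image (bond c)

/-- Membership in the boundary. [cite: Jensen2006HoneycombPolygons, §2] -/
theorem mem_bdry_iff {S : Finset Cell} {e : Sym2 (Site 2)} :
    e ∈ bdry S ↔ ∃ c ∈ S, ∃ d ∈ nbrs c, d ∉ S ∧ bond c d = e := by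
  simp only [bdry, mem_biUnion, mem_image, mem_sdiff]
  constructor
  · rintro ⟨c, hc, d, ⟨hd, hdS⟩, he⟩; exact ⟨c, hc, d, hd, hdS, he⟩
  · rintro ⟨c, hc, d, hd, hdS, he⟩; exact ⟨c, hc, d, ⟨hd, hdS⟩, he⟩

/-- A boundary bond, named by its inner and outer hexagon. [cite: Jensen2006HoneycombPolygons, §2] -/
theorem bond_mem_bdry {S : Finset Cell} {c d : Cell} (hc : c ∈ S) (hd : d ∈ nbrs c) (hdS : d ∉ S) : bond c d ∈ bdry S :=
  mem_bdry_iff.2 ⟨c, hc, d, hd, hdS, rfl⟩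

/-- The boundary consists of bonds of the brick wall. [cite: EntingJensen2009, §7.4.2, Fig. 7.10] -/
theorem bdry_subset_edgeSet {S : Finset Cell} (hS : IsBrickSet S) : ∀ e ∈ bdry S, e ∈ brickWallGraph.edgeSet := by
  intro e he
  obtain ⟨c, hc, d, hd, -, rfl⟩ := mem_bdry_iff.1 he
  exact bond_mem_edgeSet (hS c hc) hd

/-- ★ **The boundary has `perim S` bonds** (for a set of bricks). [cite: Jensen2006HoneycombPolygons, §2 (perimeter = number of boundary bonds)] -/
theorem card_bdry {S : Finset Cell} (hS : IsBrickSet S) : #(bdry S) = perim S := by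
  rw [bdry, card_biUnion]
  · refine sum_congr rfl fun c _ => ?_
    exact card_image_of_injOn ((bond_injOn c).mono (by intro d hd; exact (mem_sdiff.1 hd).1))
  · intro c hc c' hc' hne
    rw [Function.onFun, disjoint_left]
    intro e he he'
    obtain ⟨d, hd, rfl⟩ := mem_image.1 he
    obtain ⟨d', hd', h⟩ := mem_image.1 he'
    rcases cells_of_bond_eq (hS c hc) (hS c' hc') (mem_sdiff.1 hd).1 (mem_sdiff.1 hd').1 h.symm with ⟨e1, -⟩ | ⟨-, e2⟩
    · exact hne e1
    · exact (mem_sdiff.1 hd).2 (e2 ▸ hc')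

/-- Inserting a hexagon: the bonds towards its contacts leave the boundary, the bonds towards its free neighbours enter it (the bond-set
form of `perim_insert`). [cite: MadrasSlade1993, §3.2 (proof of Theorem 3.2.3: the local modification of the polygon at one unit cell)] -/
theorem bdry_insert {S : Finset Cell} {c : Cell} (hS : IsBrickSet S) (hc : Even (c.1 + c.2)) (hcS : c ∉ S) :
    bdry (insert c S) = bdry S \ (nbrs c ∩ S).image (bond c) ∪ (nbrs c \ S).image (bond c) := by
  ext e
  simp only [mem_union, mem_sdiff, mem_image, mem_inter, mem_bdry_iff, mem_insert]
  constructor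
  · rintro ⟨a, ha, d, hd, hdS, rfl⟩
    rw [not_or] at hdS
    rcases ha with rfl | ha
    · exact Or.inr ⟨d, ⟨hd, hdS.2⟩, rfl⟩
    · refine Or.inl ⟨⟨a, ha, d, hd, hdS.2, rfl⟩, ?_⟩
      rintro ⟨d'', ⟨hd'', hd''S⟩, h⟩
      rcases cells_of_bond_eq hc (hS a ha) hd'' hd h with ⟨e1, -⟩ | ⟨e1, -⟩
      · exact hcS (by rw [e1]; exact ha)
      · exact hdS.1 e1.symm
  · rintro (⟨⟨a, ha, d, hd, hdS, rfl⟩, hP⟩ | ⟨d, ⟨hd, hdS⟩, rfl⟩)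
    · refine ⟨a, Or.inr ha, d, hd, ?_, rfl⟩
      rintro (rfl | hdS')
      · exact hP ⟨a, ⟨mem_nbrs_comm.1 hd, ha⟩, bond_comm _ _⟩
      · exact hdS hdS'
    · exact ⟨c, Or.inl rfl, d, hd, fun h => h.elim (fun e => self_notMem_nbrs c (e ▸ hd)) hdS, rfl⟩

/-! ### The boundary determines the set of hexagons -/

/-- Key step: the top hexagon of the symmetric difference of two brick sets with the same boundary cannot lie in the first and not the second.
[cite: Jensen2006HoneycombPolygons, §2] -/
theorem false_of_bdry_eq_of_isLexmax_symmDiff {S T : Finset Cell} (hS : IsBrickSet S) (hT : IsBrickSet T) (h : bdry S = bdry T)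
    {m : Cell} (hm : IsLexmax (symmDiff S T) m) (hmS : m ∈ S) (hmT : m ∉ T) : False := by
  have hur : UR m ∈ nbrs m := by rw [mem_nbrs_iff]; simp [UR]
  have hm' : m ∈ nbrs (UR m) := by rw [mem_nbrs_iff]; left; ext <;> simp [UR]
  -- `UR m` is above the top of `S ∆ T`, hence in both or in neither
  have hiff : UR m ∈ S ↔ UR m ∈ T := by
    have hnot : UR m ∉ symmDiff S T := hm.ur_notMem
    rw [mem_symmDiff] at hnot
    tauto
  by_cases hurS : UR m ∈ S
  · -- the bond `UR m | m` bounds `T` but not `S`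
    have hb : bond (UR m) m ∈ bdry T := bond_mem_bdry (hiff.1 hurS) hm' hmT
    rw [← h, mem_bdry_iff] at hb
    obtain ⟨a, ha, d, hd, hdS, hbd⟩ := hb
    rcases cells_of_bond_eq (hS a ha) (hS _ hurS) hd hm' hbd with ⟨-, e2⟩ | ⟨-, e2⟩
    · exact hdS (e2 ▸ hmS)
    · exact hdS (e2 ▸ hurS)
  · -- the bond `m | UR m` bounds `S` but not `T`
    have hb : bond m (UR m) ∈ bdry S := bond_mem_bdry hmS hur hurS
    rw [h, mem_bdry_iff] at hb
    obtain ⟨a, ha, d, hd, hdT, hbd⟩ := hb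
    rcases cells_of_bond_eq (hT a ha) (hS m hmS) hd hur hbd with ⟨e1, -⟩ | ⟨e1, -⟩
    · exact hmT (e1 ▸ ha)
    · exact hurS (hiff.2 (e1 ▸ ha))

/-- ★ **Two finite sets of bricks with the same boundary are equal.** [cite: Jensen2006HoneycombPolygons, §2 (a polygon is determined by its
boundary; here for arbitrary finite sets of hexagons)] -/
theorem eq_of_bdry_eq {S T : Finset Cell} (hS : IsBrickSet S) (hT : IsBrickSet T) (h : bdry S = bdry T) : S = T := by
  by_contra hne
  have hD : (symmDiff S T).Nonempty := by
    rw [nonempty_iff_ne_empty]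
    intro h0
    exact hne (symmDiff_eq_bot.1 (h0.trans bot_eq_empty.symm))
  obtain ⟨m, hm⟩ := exists_isLexmax hD
  rcases (mem_symmDiff.1 hm.1) with ⟨hmS, hmT⟩ | ⟨hmT, hmS⟩
  · exact false_of_bdry_eq_of_isLexmax_symmDiff hS hT h hm hmS hmT
  · exact false_of_bdry_eq_of_isLexmax_symmDiff hT hS h.symm (by rwa [symmDiff_comm]) hmT hmS

/-- The boundary of a nonempty finite brick set is nonempty (its top hexagon has a free upper-right bond).
[cite: Jensen2006HoneycombPolygons, §2] -/
theorem bdry_nonempty {S : Finset Cell} (hS : S.Nonempty) : (bdry S).Nonempty := by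
  obtain ⟨t, ht⟩ := exists_isLexmax hS
  have hur : UR t ∈ nbrs t := by rw [mem_nbrs_iff]; simp [UR]
  exact ⟨_, bond_mem_bdry ht.1 hur ht.ur_notMem⟩

end HexCell

end Literature.Probability.RandomPlanarGeometry.SAW
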